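import Summits.BirchSwinnertonDyer.BirchSwinnertonDyer.Theorems.EisensteinPrimesMazurMCOnX1RankZeroInterludeResidualGL1EvenTwist
import Literature.NumberTheory.IwasawaTheory.GreenbergCyclicOrderP
import Summits.BirchSwinnertonDyer.BirchSwinnertonDyer.Theorems.EisensteinPrimesMazurMCOnX1RankZeroInterludeResidualGL1Tame
import Literature.NumberTheory.EllipticCurves.H1CorestrictionIndexTwo
import Literature.NumberTheory.EllipticCurves.GreenbergVatsal2000.UnramifiedOutsideFinite
import Literature.NumberTheory.EllipticCurves.CyclotomicZpExtension
import Literature.NumberTheory.EllipticCurves.ZpExtensionProofs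
import Literature.NumberTheory.EllipticCurves.HeegnerPointsImaginaryQuadraticProofs
import Literature.NumberTheory.GaloisRepresentations.AbsIntegersEquiv
import Literature.NumberTheory.GaloisRepresentations.InducedGaloisRep
import Literature.NumberTheory.GaloisRepresentations.ArtinFormalismInductionProofs
import HarnessLib

/-!
# Crux `MazurMCOnX1RankZero` (item stmt-BirchSwinnertonDyer-19035), line `interlude_with_torsion`, road B input [Even] FROM GREENBERG'S LEMMA 5.9: the swap changes sign under the twist and the ASSEMBLY `greenbergEvenInput_of_lemma59` (§9)

Cell `bsd-eis` (host `run/shared/lean/pub/bsd-eis/`), LEAD `cruxlead-19035` (g0); `--supports` stmt-BirchSwinnertonDyer-19035 as a HELPER.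
Part of the move of the ideator bsd-idea-11 g17's workfile `Cruxes/MazurMCOnX1RankZero/Lines/interlude_roadB_EvenTransport_idea11g17.lean`
(sorry-free; mathematics by that seat, verbatim; split at the 400-line limit into `…InterludeResidualGL1Even{IndexTwo,Core,Twist,}`) into `Theorems/`,
so that the registered stub `stub_greenbergEvenInput` of skeleton v10 ([Even] = Greenberg, LNM 1716, §5 Lemma 5.9 read over `K_∞ ⊃ ℚ_∞`) is
closed MODULO the PUBLISHED named fact `Literature.NumberTheory.IwasawaTheory.greenberg1999_lemma59_even_finite` (p693821). HONEST FRAMING: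
kernel plumbing (inflation–restriction along the index-2 pair `res(ker κ_K) ⊲ ker κ_ℚ`, corestriction, the quadratic twist `M ⊗ ε_K`);
nothing about BSD, Mazur's main conjecture or IMC2 is asserted; Greenberg's Lemma 5.9 itself is NOT proved (named fact).
Contents: §9 `cycSwapH1_twist` (T_{c₀}(M ⊗ ε_K) = −T_{c₀}(M)) and **`greenbergEvenInput_of_lemma59 : greenberg1999_lemma59_even_finite →
<type of stub_greenbergEvenInput, token for token>`** — [Even] BY the PUBLISHED Lemma 5.9 over `ℚ_∞`.
[cite: Greenberg1999LNM, §5 Lemma 5.9 and proof of Prop. 5.10] [cite: SerreGaloisCohomology1997, I §2.4, I §5.8] [cite: GreenbergVatsal2000, §2]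
-/

noncomputable section

set_option linter.dupNamespace false
set_option autoImplicit false

open scoped NumberField Pointwise
open Field IsDedekindDomain
open Literature.NumberTheory.GaloisRepresentations
open Literature.NumberTheory.EllipticCurves Literature.NumberTheory.EllipticCurves.GreenbergSelmer
open Literature.NumberTheory.EllipticCurves.GreenbergVatsal2000

namespace Summit.BirchSwinnertonDyer.BirchSwinnertonDyer.Theorems.InterludeWithTorsion.EvenTransport
/-! ## §9 The swap changes sign under the twist; the display form of Greenberg's Lemma 5.9; assembly of [Even] -/

section Assembly

variable {K : Type} [Field K] [NumberField K] [IsGalois ℚ K] [Fact (Module.finrank ℚ K = 2)] {p : ℕ} [Fact p.Prime]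
variable (κ : ZpExtension K p) (hκ : κ.IsCyclotomic)
variable (M : Type) [AddCommGroup M] [DistribMulAction (absoluteGaloisGroup ℚ) M]
  [DistribMulAction (absoluteGaloisGroup K) M] [TopologicalSpace M] [DiscreteTopology M]
  (hM : ∀ (σ : absoluteGaloisGroup K) (m : M), σ • m = absGaloisRestrict ℚ K σ • m)

/-- **`T_{c₀}` on `H¹(ker κ_K, M ⊗ ε_K)` is `-T_{c₀}` on `H¹(ker κ_K, M)`** for `c₀ ∉ res(Γ_K)` (the two `H¹` are the same
group: `ker κ_K ≤ Γ_K` acts identically). [cite: SerreGaloisCohomology1997, I §5.3 (twisting)] [folklore] -/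
theorem cycSwapH1_twist {c₀ : absoluteGaloisGroup ℚ} (hc₀K : c₀ ∉ Set.range (absGaloisRestrict ℚ K))
    (x : subgroupH1 κ.kerSubgroup M) :
    Twist.h1Cast κ.kerSubgroup (cycSwapH1 κ hκ (Twist K M) (Twist.compat hM) c₀ (Twist.h1CastInv κ.kerSubgroup x)) =
      -cycSwapH1 κ hκ M hM c₀ x := by
  obtain ⟨z, rfl⟩ := oneCocycleClass_surjective _ x
  have hw : Twist.cocycleCast κ.kerSubgroup
      (contOneCocycles.pullback (outerConjSubgroup κ.kerSubgroup (absGaloisOuterConj_mem_kerSubgroup κ hκ) c₀)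
        (resHomOfEquivariant _ _ (outerConj_compat κ.kerSubgroup (absGaloisOuterConj_mem_kerSubgroup κ hκ) (Twist K M)
          (Twist.compat hM) c₀))
        (Twist.cocycleCastInv κ.kerSubgroup z)) =
      -contOneCocycles.pullback (outerConjSubgroup κ.kerSubgroup (absGaloisOuterConj_mem_kerSubgroup κ hκ) c₀)
        (resHomOfEquivariant _ _ (outerConj_compat κ.kerSubgroup (absGaloisOuterConj_mem_kerSubgroup κ hκ) M hM c₀))
        z := by
    apply Subtype.ext
    ext σ
    show Twist.val (K := K)
        (c₀ • Twist.of (K := K) (z.1 (outerConjSubgroup κ.kerSubgroup (absGaloisOuterConj_mem_kerSubgroup κ hκ) c₀ σ))) =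
      -(c₀ • z.1 (outerConjSubgroup κ.kerSubgroup (absGaloisOuterConj_mem_kerSubgroup κ hκ) c₀ σ))
    rw [Twist.smul_of_not_mem (M := M) hc₀K, Twist.val_of, Twist.val_of]
  rw [Twist.h1CastInv_oneCocycleClass, cycSwapH1_eq κ hκ (Twist K M), outerConjH1_oneCocycleClass,
    Twist.h1Cast_oneCocycleClass, hw, oneCocycleClass_neg', cycSwapH1_eq κ hκ M hM, outerConjH1_oneCocycleClass]

end Assembly

/-- **[Even] from Greenberg's Lemma 5.9 over `ℚ_∞`.** The conclusion is, token for token, the hypothesis `hEven` of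
`InterludeWithTorsion.residualGL1FinitenessOdd_of_unr_even'` (= the type of `stub_greenbergEvenInput` of the skeleton
`interlude_with_torsion` v10). Proof: `τ = c₀` a complex conjugation (`∉ res(Γ_K)`, `K` imaginary quadratic); if the
`ker κ_K`-action is not continuous, `H¹ = 0` (`discreteH1_eq_zero_of_not_continuous`); else the action is `Γ_ℚ`-continuous
(§7), `c₀` acts by `±1` (§6); for `+1`, `(1 + T_{c₀}) U_K ⊆ Ψ res_N cor Φ (U_K) ⊆ Ψ res_N (U_ℚ)` is finite by Lemma 5.9 for
`M` (Core⁺, §5); for `-1`, the same for the even module `M ⊗ ε_K` (§8), whose swap is `-T_{c₀}` (§9).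
[cite: Greenberg1999LNM, Lemma 5.9] [cite: SerreGaloisCohomology1997, I §2.4] -/
theorem greenbergEvenInput_of_lemma59 (hL : Literature.NumberTheory.IwasawaTheory.greenberg1999_lemma59_even_finite) :
    ∀ (K : Type) [Field K] [NumberField K] [IsGalois ℚ K], IsImaginaryQuadratic K →
      ∀ (p : ℕ) [Fact p.Prime], p ≠ 2 →
      ∀ (κ : ZpExtension K p) (hκ : κ.IsCyclotomic),
      ∀ (M : Type) [AddCommGroup M] [DistribMulAction (absoluteGaloisGroup ℚ) M]
        [DistribMulAction (absoluteGaloisGroup K) M] [TopologicalSpace M] [DiscreteTopology M],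
        Nat.card M = p →
        ∀ (hM : ∀ (σ : absoluteGaloisGroup K) (m : M), σ • m = (absGaloisRestrict ℚ K σ) • m),
        ∃ τ : absoluteGaloisGroup ℚ, τ ∉ Set.range (absGaloisRestrict ℚ K) ∧
          (((fun c ↦ c + cycSwapH1 κ hκ M hM τ c) ''
              (unramifiedOutside κ.kerSubgroup M p ∅ : Set (subgroupH1 κ.kerSubgroup M))).Finite ∨
            ((fun c ↦ c - cycSwapH1 κ hκ M hM τ c) ''
              (unramifiedOutside κ.kerSubgroup M p ∅ : Set (subgroupH1 κ.kerSubgroup M))).Finite) := by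
  intro K _ _ _ hK p _ hp2 κ hκ M _ _ _ _ _ hcard hM
  haveI : Fact (Module.finrank ℚ K = 2) := ⟨hK.1⟩
  have hp : p.Prime := Fact.out
  have hpM : (Nat.card M).Prime := by rwa [hcard]
  -- `τ = c₀`, a complex conjugation
  obtain ⟨c₀, hc₀cc⟩ := exists_isComplexConjugation (Rat.castHom ℝ)
  have hc₀ : c₀ * c₀ = 1 := by rw [← pow_two]; exact hc₀cc.sq_eq_one
  have hc₀K : c₀ ∉ Set.range (absGaloisRestrict ℚ K) := hc₀cc.not_mem_range_absGaloisRestrict hK.2.isComplex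
  refine ⟨c₀, hc₀K, ?_⟩
  -- junk case: non-continuous action
  by_cases hcont : ∀ m : M, Continuous fun g : κ.kerSubgroup ↦ g • m
  swap
  · haveI : Subsingleton (subgroupH1 κ.kerSubgroup M) := ⟨fun a b ↦ by
      rw [discreteH1_eq_zero_of_not_continuous hpM hcont a, discreteH1_eq_zero_of_not_continuous hpM hcont b]⟩
    exact Or.inl (Set.toFinite _)
  -- continuity of the `Γ_K`- and `Γ_ℚ`-actions
  haveI : Finite M := Nat.finite_of_card_ne_zero (hcard ▸ hp.ne_zero)
  have hMK : ∀ m : M, Continuous fun g : absoluteGaloisGroup K ↦ g • m :=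
    continuous_smul_of_continuous_smul_kerSubgroup κ hcont
  have hMQ : ∀ m : M, Continuous fun g : absoluteGaloisGroup ℚ ↦ g • m :=
    continuous_smul_of_continuous_restrict K hM hMK
  -- the cyclotomic `ℤ_p`-extension of `ℚ`
  have hκQ := CyclotomicZp.isCyclotomic_zpExtension p
  -- parity of `c₀` on `M`
  rcases smul_eq_self_or_eq_neg (M := M) hcard hc₀ with heven | hodd
  · -- `c₀ = +1` on `M`: `M` is even
    left
    have hev : ∀ c : absoluteGaloisGroup ℚ, IsComplexConjugation (Rat.castHom ℝ) c → ∀ m : M, c • m = m :=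
      fun c hc m ↦ by rw [smul_eq_smul_of_isConj hcard (hc₀cc.isConj hc) m, heven]
    have hfinQ := hL p hp2 (CyclotomicZp.zpExtension p) hκQ M hcard hMQ hev
    exact finite_image_add_cycSwapH1 κ hκ (CyclotomicZp.zpExtension p) hκQ M hM hMQ hc₀ hc₀K hp2 hcard hfinQ
  · -- `c₀ = -1` on `M`: `M ⊗ ε_K` is even
    right
    have hM' := Twist.compat (K := K) (M := M) hM
    have hMK' : ∀ x : Twist K M, Continuous fun g : absoluteGaloisGroup K ↦ g • x := fun x ↦ hMK x.val
    have hMQ' : ∀ x : Twist K M, Continuous fun g : absoluteGaloisGroup ℚ ↦ g • x :=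
      continuous_smul_of_continuous_restrict K hM' hMK'
    have hcard' : Nat.card (Twist K M) = p := hcard
    have hev' : ∀ c : absoluteGaloisGroup ℚ, IsComplexConjugation (Rat.castHom ℝ) c → ∀ x : Twist K M, c • x = x :=
      fun c hc x ↦ Twist.smul_eq_self_of_not_mem
        (fun m ↦ by rw [smul_eq_smul_of_isConj hcard (hc₀cc.isConj hc) m, hodd])
        (hc.not_mem_range_absGaloisRestrict hK.2.isComplex) x
    have hfinQ := hL p hp2 (CyclotomicZp.zpExtension p) hκQ (Twist K M) hcard' hMQ' hev'
    have hfinT := finite_image_add_cycSwapH1 κ hκ (CyclotomicZp.zpExtension p) hκQ (Twist K M) hM' hMQ' hc₀ hc₀K hp2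
      hcard' hfinQ
    have key := cycSwapH1_twist κ hκ M hM hc₀K
    refine (hfinT.image (Twist.h1Cast (K := K) (M := M) κ.kerSubgroup)).subset ?_
    rintro _ ⟨c, hc, rfl⟩
    refine ⟨Twist.h1CastInv κ.kerSubgroup c +
        cycSwapH1 κ hκ (Twist K M) hM' c₀ (Twist.h1CastInv κ.kerSubgroup c),
      ⟨Twist.h1CastInv κ.kerSubgroup c, hc, rfl⟩, ?_⟩
    rw [map_add, key c, ← sub_eq_add_neg]
    rfl

/-- **(B3) from the two printed inputs [Unr] and Lemma 5.9** — `InterludeWithTorsion.ResidualGL1FinitenessOdd` (the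
statement of the registered stub `stub_residualGL1FinitenessOdd`), by `residualGL1FinitenessOdd_of_unr_even'` (tree) with
`hEven := greenbergEvenInput_of_lemma59`. The input `hUnr` is the displayed [Unr] (tree hypothesis shape; it is derived
from Ferrero–Washington `μ = 0` + finiteness of unramified classes in the companion workfile
`Lines/interlude_roadB_UnrTransport_idea11g17.lean`, `unrInput_of_ferreroWashington`). No summit statement, Mazur main
conjecture or BSD instance is proved by this. [cite: Greenberg1999LNM, Lemma 5.9] [cite: FerreroWashington1979] -/
theorem residualGL1FinitenessOdd_of_unr_lemma59
    (hUnr : ∀ (K : Type) [Field K] [NumberField K], IsImaginaryQuadratic K →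
      ∀ (p : ℕ) [Fact p.Prime], p ≠ 2 →
      ∀ (κ : ZpExtension K p), κ.IsCyclotomic →
      ∀ (M : Type) [AddCommGroup M] [DistribMulAction (absoluteGaloisGroup ℚ) M]
        [DistribMulAction (absoluteGaloisGroup K) M] [TopologicalSpace M] [DiscreteTopology M],
        Nat.card M = p →
        (∀ (σ : absoluteGaloisGroup K) (m : M), σ • m = (absGaloisRestrict ℚ K σ) • m) →
        {c : subgroupH1 κ.kerSubgroup M | ∀ (v : HeightOneSpectrum (𝓞 K)) (σ : absoluteGaloisGroup K),
          conjH1 κ.kerSubgroup M σ c ∈ GreenbergVatsal2000.unramifiedKer κ.kerSubgroup M v}.Finite)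
    (hL : Literature.NumberTheory.IwasawaTheory.greenberg1999_lemma59_even_finite) : InterludeWithTorsion.ResidualGL1FinitenessOdd :=
  residualGL1FinitenessOdd_of_unr_even' hUnr (greenbergEvenInput_of_lemma59 hL)


end Summit.BirchSwinnertonDyer.BirchSwinnertonDyer.Theorems.InterludeWithTorsion.EvenTransport
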